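import Summits.BirchSwinnertonDyer.BirchSwinnertonDyer.Theorems.GenusKolyvaginAtTwoGenusPrimitiveSupplyAtTwoPosDiscShallowSilentReductionBit
import Summits.BirchSwinnertonDyer.BirchSwinnertonDyer.Theorems.GenusKolyvaginAtTwoShaCardDvdPowAtTwoPosTOnCutRankQ
import Summits.BirchSwinnertonDyer.BirchSwinnertonDyer.Theorems.GenusKolyvaginAtTwoEquivariantKolyvaginExactAtTwoLocalTorsionCount
import HarnessLib

/-!
# Route `GenusKolyvaginAtTwo`, crux 25504 (Δ>0 supply): THE REDUCTION BIT R₁⁺ HOLDS ONLY ON AN EMPTY FRAME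
# (`R₁⁺ → ∀ frame of the K₁⁺ cell, False`) — kernel form of memo `R1POS-VACUOUS-gk2p5-g34.md`

Seat `bsd-line-gk2-p5` g34 (cell `bsd-f1-sign2`, WIDTH-5 attach), `--supports stmt-BirchSwinnertonDyer-25504 --as helper`.  THEOREMS ONLY (no
definition, no named fact, no `sorry`); UNCONDITIONAL.  **BSD is NOT proved by this file and no item is closed by it; nothing is refuted** (R₁⁺ is
a hypothesis of the ledger `DepthZero.nonCMAtTwo_of_items_of_reductionBits`, p762861, not an item): the file shows that this hypothesis can
only be supplied by showing that the `#Sel₂(E) = 1` cell of the Δ>0 supply has NO frame at all — so it must not be itemised; the correct Δ>0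
depth-zero bit is archimedean (memo §3), and K₁⁺ itself is lossless (`Lossless.K1_pos_of_nonCMAtTwo`, p763825).

* §1 `natCard_twoTorsion_reductionAt_eq_natCard_ker_zsmul_adicCompletion` — **`#Ẽ_v(k_v)[2] = #E(ℚ_v)[2]`** at an odd good prime WITHOUT
  Hensel: both equal `#{u ∈ E[2] : Φ u = u}` for a Frobenius `Φ` (`FrobShape.exists_frobenius_natCard_fixed_eq` moved to `adicCompletionPrime`,
  gk2-p3 g10's `ReductionCyclic.natCard_ker_zsmul_adicCompletion_eq`); `…_eq_one_of_twoTorsion_padic_eq_zero` — silent in the `ℚ_ℓ`-currency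
  ⟹ `#Ẽ_v(k_v)[2] = 1`.
* §2 `natCard_twoTorsion_reductionAt_eq_one_of_allSilentTwin` — on the Heegner frame with `C(W)` odd and an ALL-SILENT twin (`ord₂ C(Wd) = 0`),
  EVERY prime `ℓ ∣ d_K` has `#Ẽ_v(k_v)[2] = 1` (gk2-p3 g27's `forall_twoTorsion_padic_eq_zero_of_padicValNat_two_tamagawaProduct_twin_eq_zero` + §1).
* §3 **`frame_empty_of_reductionBitPos`** — with `hR` = R₁⁺ VERBATIM (the hypothesis `hR` of `DepthZero.K1_pos_of_reductionBit`, p762538 =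
  binder `hR1pos` of p762861): every frame of the K₁⁺ cell (R₁⁺'s own antecedents) is contradictory, since the bit R₁⁺ produces at some `ℓ ∣ d_K`
  fails there by `DepthZeroSilent.reductionBit_fails_of_natCard_twoTorsion_reductionAt_eq_one` (p764232) and §2.  Pen g22's census (ACCT-S3,
  SUPFALS: evidence on 25504) exhibits 31 453 such frames numerically (`Wd.analyticRank = 1` is not kernel-decidable, so `¬ R₁⁺` is not claimed).

References: [SilvermanAEC2009] Prop. VII.3.1(b), VII.4.1(a); [MilneADT2006] I Lemma 3.3; [Kramer1981] §2 Prop. 3; [GrossLMS1991] §5 Prop. 5.3;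
[MazurRubin2010] Lemma 2.2 (i).
-/

set_option autoImplicit false
set_option linter.dupNamespace false -- `Summit.<P>.<Sub>` repeats `BirchSwinnertonDyer` (D-0017)

noncomputable section

open scoped Classical NumberField Pointwise

namespace Summit.BirchSwinnertonDyer.BirchSwinnertonDyer.Theorems.GenusSupplyNarrow.DepthZeroSilent

open IsDedekindDomain Field NumberField WeierstrassCurve Literature.NumberTheory.EllipticCurves
  Literature.NumberTheory.EllipticCurves.ModularForms Literature.NumberTheory.GaloisRepresentations Rat.HeightOneSpectrum
  Summit.BirchSwinnertonDyer.BirchSwinnertonDyer.Theorems.GenusExact.PlusDescent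
  Summit.BirchSwinnertonDyer.BirchSwinnertonDyer.Theorems.GenusExact.ReductionCyclic

/-! ## §1 `#Ẽ_v(k_v)[2] = #E(ℚ_v)[2]` through the Frobenius-fixed count -/

/-- **`#Ẽ_v(k_v)[2] = #E(ℚ_v)[2]`** (`W/ℚ` globally minimal, `ℓ` an odd prime of good reduction, `v ∋ ℓ`): both sides count the fixed points
on `E[2]` of an arithmetic Frobenius — the counting Frobenius `σ₀` of `FrobShape.exists_frobenius_natCard_fixed_eq` (Silverman VII.3.1(b)),
conjugated to the prime `adicCompletionPrime ℚ v` of the chosen embedding `ℚ̄ → ℚ̄_v`, where `#E(ℚ_v)[2] = #E[2]^{Φ}` (Milne I Lemma 3.3,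
inertia trivial on `E[2]`; gk2-p3 g10 `natCard_ker_zsmul_adicCompletion_eq`).  No Hensel lifting is used.
[cite: SilvermanAEC2009, Prop. VII.3.1(b), Prop. VII.4.1(a)] [cite: MilneADT2006, I Lemma 3.3] -/
theorem natCard_twoTorsion_reductionAt_eq_natCard_ker_zsmul_adicCompletion (W : WeierstrassCurve ℚ) [W.IsElliptic]
    [W.IsGloballyMinimal] {ℓ : ℕ} [Fact ℓ.Prime] (hℓ2 : ℓ ≠ 2) (hgoodℓ : W.HasGoodReductionAtPrime ℓ)
    {v : HeightOneSpectrum (𝓞 ℚ)} (hvℓ : (ℓ : 𝓞 ℚ) ∈ v.asIdeal) :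
    Nat.card (AddSubgroup.torsionBy (W.reductionAt v).toAffine.Point ((2 : ℕ) : ℤ)) =
      Nat.card (zsmulAddGroupHom ((2 : ℕ) : ℤ) : (W.baseChange (v.adicCompletion ℚ)).toAffine.Point →+ _).ker := by
  haveI : Fact (Nat.Prime 2) := ⟨Nat.prime_two⟩
  have hℓp : ℓ.Prime := Fact.out
  have hvp : (primesEquiv v : ℕ) = ℓ := primesEquiv_eq_of_natCast_mem hℓp hvℓ
  have hgood : W.HasGoodReductionAt v := (hasGoodReductionAtPrime_primesEquiv_iff_holds W v ℓ hvp).mp hgoodℓ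
  have hnv : ((((2 : ℕ) : ℤ)) : 𝓞 ℚ) ∉ v.asIdeal := by
    intro hmem
    have h2 : ((2 : ℕ) : 𝓞 ℚ) ∈ v.asIdeal := by exact_mod_cast hmem
    exact hℓ2 (hvp.symm.trans (primesEquiv_eq_of_natCast_mem Nat.prime_two h2))
  -- the counting Frobenius, moved to `adicCompletionPrime ℚ v`
  obtain ⟨σ₀, 𝔓₀', h𝔓₀', hσ₀, hcount⟩ :=
    Summit.BirchSwinnertonDyer.Rank1Residual.GaloisImage.FrobShape.exists_frobenius_natCard_fixed_eq W 2 ℓ hℓ2 hgoodℓ hvℓ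
  have h𝔓₀ := adicCompletionPrime_mem_primesAbove ℚ v
  obtain ⟨g, hg⟩ := HeightOneSpectrum.exists_smul_eq_of_mem_primesAbove_holds h𝔓₀' h𝔓₀
  have hΦ : IsArithFrobAt (𝓞 ℚ) (g * σ₀ * g⁻¹) (adicCompletionPrime ℚ v) := hg ▸ hσ₀.conj g
  rw [natCard_ker_zsmul_adicCompletion_eq W (by norm_num) hgood hnv hΦ]
  have hcongr : Nat.card {P : geomTorsion W ((2 : ℕ) : ℤ) // (g * σ₀ * g⁻¹) • P = P} =
      Nat.card {P : geomTorsion W ((2 : ℕ) : ℤ) // σ₀ • P = P} := by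
    refine Nat.card_congr
      { toFun := fun P ↦ ⟨g⁻¹ • P.1, by
          have h := P.2
          rw [mul_smul, mul_smul] at h
          have h' := congrArg (fun Q ↦ g⁻¹ • Q) h
          simpa only [inv_smul_smul] using h'⟩
        invFun := fun Q ↦ ⟨g • Q.1, by rw [mul_smul, mul_smul, inv_smul_smul, Q.2]⟩
        left_inv := fun P ↦ Subtype.ext (smul_inv_smul g P.1)
        right_inv := fun Q ↦ Subtype.ext (inv_smul_smul g Q.1) }
  have hc1 := hcount 1
  rw [pow_one] at hc1
  rw [hcongr, hc1]

/-- **Silent in the `ℚ_ℓ`-currency ⟹ `#Ẽ_v(k_v)[2] = 1`**: if `E(ℚ_ℓ)` has no point of order `2` (`ℓ` odd good, `v ∋ ℓ`), then the reduction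
has no `k_v`-rational point of order `2` (§1, the tree's `ℚ_v ≃ ℚ_ℓ` transport `natCard_ker_nsmul_adicCompletion_eq_padic`).
[cite: SilvermanAEC2009, Prop. VII.3.1(b)] [cite: MazurRubin2010, Lemma 2.2 (i)] -/
theorem natCard_twoTorsion_reductionAt_eq_one_of_twoTorsion_padic_eq_zero (W : WeierstrassCurve ℚ) [W.IsElliptic]
    [W.IsGloballyMinimal] {ℓ : ℕ} [Fact ℓ.Prime] (hℓ2 : ℓ ≠ 2) (hgoodℓ : W.HasGoodReductionAtPrime ℓ)
    {v : HeightOneSpectrum (𝓞 ℚ)} (hvℓ : (ℓ : 𝓞 ℚ) ∈ v.asIdeal)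
    (hsil : ∀ Q : (W.baseChange ℚ_[ℓ]).toAffine.Point, 2 • Q = 0 → Q = 0) :
    Nat.card (AddSubgroup.torsionBy (W.reductionAt v).toAffine.Point ((2 : ℕ) : ℤ)) = 1 := by
  have hℓp : ℓ.Prime := Fact.out
  have hvp : ((primesEquiv v : Nat.Primes) : ℕ) = ℓ := primesEquiv_eq_of_natCast_mem hℓp hvℓ
  rw [natCard_twoTorsion_reductionAt_eq_natCard_ker_zsmul_adicCompletion W hℓ2 hgoodℓ hvℓ]
  -- `zsmul` kernel = `nsmul` kernel
  have hzn : Nat.card (zsmulAddGroupHom ((2 : ℕ) : ℤ) : (W.baseChange (v.adicCompletion ℚ)).toAffine.Point →+ _).ker =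
      Nat.card (nsmulAddMonoidHom 2 : (W.baseChange (v.adicCompletion ℚ)).toAffine.Point →+ _).ker := by
    refine Nat.card_congr (Equiv.subtypeEquivRight fun Q ↦ ?_)
    simp only [AddMonoidHom.mem_ker, zsmulAddGroupHom_apply, nsmulAddMonoidHom_apply, natCast_zsmul]
  rw [hzn, GenusKolyTwistLocal.natCard_ker_nsmul_adicCompletion_eq_padic W v 2]
  subst hvp
  rw [Nat.card_eq_one_iff_unique]
  exact ⟨⟨fun a b ↦ Subtype.ext ((hsil a.1 a.2).trans (hsil b.1 b.2).symm)⟩, ⟨⟨0, by simp⟩⟩⟩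

/-! ## §2 On the all-silent twin EVERY prime of `d_K` has `#Ẽ(𝔽_ℓ)[2] = 1` -/

variable {K : Type} [Field K] [NumberField K]

/-- **All-silent twin ⟹ `#Ẽ_v(k_v)[2] = 1` at every `ℓ ∣ d_K`.**  `W/ℚ` globally minimal with `C(W)` odd, `K` imaginary quadratic with odd `d_K`,
Heegner for `N_W`, `Wd = Cd • W^(d_K)` with `ord₂ C(Wd) = 0`; `ℓ ∣ d_K` prime, `v ∋ ℓ`.  (gk2-p3 g27: `ord₂ C(Wd) = 0` ⟹ `W(ℚ_ℓ)[2] = 0`; §1.)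
[cite: Kramer1981, §2 Prop. 3] [cite: SilvermanAEC2009, Prop. VII.3.1(b)] -/
theorem natCard_twoTorsion_reductionAt_eq_one_of_allSilentTwin (W : WeierstrassCurve ℚ) [W.IsElliptic] [W.IsGloballyMinimal]
    (hK : IsImaginaryQuadratic K) (hodd : Odd (NumberField.discr K)) (hH : SatisfiesHeegnerHypothesis (W.conductorNorm ℤ) K)
    (hTam : Odd W.tamagawaProduct) {Wd : WeierstrassCurve ℚ} [Wd.IsElliptic] (Cd : VariableChange ℚ)
    (hWd : Cd • W.quadraticTwist (NumberField.discr K : ℚ) = Wd) (hDEF : padicValNat 2 Wd.tamagawaProduct = 0)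
    {ℓ : ℕ} [Fact ℓ.Prime] (hℓd : (ℓ : ℤ) ∣ NumberField.discr K) {v : HeightOneSpectrum (𝓞 ℚ)} (hvℓ : (ℓ : 𝓞 ℚ) ∈ v.asIdeal) :
    Nat.card (AddSubgroup.torsionBy (W.reductionAt v).toAffine.Point ((2 : ℕ) : ℤ)) = 1 := by
  have hℓp : ℓ.Prime := Fact.out
  have hℓ2 : ℓ ≠ 2 := by
    rintro rfl
    obtain ⟨r, hr⟩ := hodd
    omega
  have hΔ : ¬ (ℓ : ℤ) ∣ minimalDiscriminantInt W := not_dvd_minimalDiscriminantInt_of_dvd_discr_of_heegner W K hK.1 hH hℓp hℓ2 hℓd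
  have hgoodℓ : W.HasGoodReductionAtPrime ℓ := W.hasGoodReductionAtPrime_of_not_dvd ℓ hΔ
  exact natCard_twoTorsion_reductionAt_eq_one_of_twoTorsion_padic_eq_zero W hℓ2 hgoodℓ hvℓ
    (forall_twoTorsion_padic_eq_zero_of_padicValNat_two_tamagawaProduct_twin_eq_zero W hK hodd hH hTam Cd hWd hDEF ℓ hℓd)

/-! ## §3 R₁⁺ holds only on an empty frame -/

/-- **R₁⁺ ⟹ THE `#Sel₂(E) = 1` CELL OF THE Δ>0 SUPPLY HAS NO FRAME.**  `hR` is R₁⁺ VERBATIM (hypothesis `hR` of `DepthZero.K1_pos_of_reductionBit`,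
p762538; binder `hR1pos` of `DepthZero.nonCMAtTwo_of_items_of_reductionBits`, p762861): on every frame of the cell (habitat curve `E` with `Δ > 0` and
`#Sel₂(E) = 1`, (H2)-admissible `K`, odd-Manin `Dt`, `d₁` with `y_K` of infinite order, an all-silent `2`-Selmer-minimal globally minimal twin of
analytic rank `1`) R₁⁺ supplies a good prime `ℓ ∣ d_K` and a lift `P₀ ↦ P(1)` whose reduction avoids `red(e·(E(K)_tors^{Aut}))`; but the twin is
ALL-SILENT (`ord₂ c(Wd) = 0`), so `#Ẽ_v(k_v)[2] = 1` at that `ℓ` (§2) and the bit fails for every lift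
(`reductionBit_fails_of_natCard_twoTorsion_reductionAt_eq_one`, p764232; `d_K·Δ ∉ ℚ²` from the Heegner hypothesis, `d_K ≠ −4` as `d_K` is odd).
Hence the frame is contradictory: **R₁⁺ is equivalent to «the K₁⁺ cell is empty»**, which the cell's census refutes numerically (pen ACCT-S3 /
SUPFALS on 25504); `¬ R₁⁺` itself is not a kernel statement (`Wd.analyticRank = 1`).  Nothing about BSD is proved or refuted here.
[cite: GrossLMS1991, §5 Prop. 5.3, §4 (4.1)] [cite: Kramer1981, §2 Prop. 3] [cite: SilvermanAEC2009, Prop. VII.3.1(b)] -/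
theorem frame_empty_of_reductionBitPos
    (hR : ∀ (W : WeierstrassCurve ℚ) [W.IsElliptic] [W.IsGloballyMinimal] [NeZero (W.conductorNorm ℤ)],
      ¬ W.HasCM → W.analyticRank = 0 → (∀ n : ℕ, 0 < n → W.HasSurjectiveModNGaloisRep ((2 : ℤ) ^ n)) →
      Odd W.tamagawaProduct → 0 < W.Δ →
      Nat.card (W.selmerGroup 2) = 1 →
      ∀ (K : Type) [Field K] [NumberField K],
      IsImaginaryQuadratic K → Odd (NumberField.discr K) → NumberField.discr K ≠ -3 →
      SatisfiesHeegnerHypothesis (W.conductorNorm ℤ) K →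
      ¬ IsSquare ((NumberField.discr K : ℚ) * -|W.Δ|) → ¬ IsSquare ((NumberField.discr K : ℚ) * (-(2 * |W.Δ|))) →
      ∀ (Dt : ModularParametrizationData W (W.conductorNorm ℤ)),
      (∀ z ∈ Dt.L.lattice, ∃ w ∈ periodLattice Dt.f, z = (Dt.c : ℂ) * w) → Odd Dt.c →
      ∀ (β : ℤ) (ι : K →+* ℂ) (d₁ : KolyvaginHeegnerData Dt β ι 1), ¬ IsOfFinAddOrder d₁.derivedPoint →
      ∀ (Wd : WeierstrassCurve ℚ) [Wd.IsElliptic] [Wd.IsGloballyMinimal],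
      (∃ C : WeierstrassCurve.VariableChange ℚ, C • W.quadraticTwist (NumberField.discr K : ℚ) = Wd) →
      Wd.analyticRank = 1 → Nat.card (Wd.selmerGroup 2) = 2 → padicValNat 2 Wd.tamagawaProduct = 0 →
      ∃ (ℓ : ℕ) (_ : Fact ℓ.Prime) (_ : (ℓ : ℤ) ∣ NumberField.discr K) (hΔ : ¬ (ℓ : ℤ) ∣ minimalDiscriminantInt W)
        (P₀ : (W.baseChange K).toAffine.Point),
        Affine.Point.map (W' := W) (algebraMap K (ringClassField K ι 1)).toRatAlgHom P₀ = d₁.derivedPoint ∧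
        ∀ s : (W.baseChange K).toAffine.Point, IsOfFinAddOrder s → (∀ σ : K ≃ₐ[ℚ] K, σ • s = s) →
          geomReduction hΔ (Affine.Point.map (W' := W) (absEmbedding ℚ K) P₀ : W.geomPoints) ≠
            geomReduction hΔ (Affine.Point.map (W' := W) (absEmbedding ℚ K) s : W.geomPoints)) :
    ∀ (W : WeierstrassCurve ℚ) [W.IsElliptic] [W.IsGloballyMinimal] [NeZero (W.conductorNorm ℤ)],
      ¬ W.HasCM → W.analyticRank = 0 → (∀ n : ℕ, 0 < n → W.HasSurjectiveModNGaloisRep ((2 : ℤ) ^ n)) →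
      Odd W.tamagawaProduct → 0 < W.Δ →
      Nat.card (W.selmerGroup 2) = 1 →
      ∀ (K : Type) [Field K] [NumberField K],
      IsImaginaryQuadratic K → Odd (NumberField.discr K) → NumberField.discr K ≠ -3 →
      SatisfiesHeegnerHypothesis (W.conductorNorm ℤ) K →
      ¬ IsSquare ((NumberField.discr K : ℚ) * -|W.Δ|) → ¬ IsSquare ((NumberField.discr K : ℚ) * (-(2 * |W.Δ|))) →
      ∀ (Dt : ModularParametrizationData W (W.conductorNorm ℤ)),
      (∀ z ∈ Dt.L.lattice, ∃ w ∈ periodLattice Dt.f, z = (Dt.c : ℂ) * w) → Odd Dt.c →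
      ∀ (β : ℤ) (ι : K →+* ℂ) (d₁ : KolyvaginHeegnerData Dt β ι 1), ¬ IsOfFinAddOrder d₁.derivedPoint →
      ∀ (Wd : WeierstrassCurve ℚ) [Wd.IsElliptic] [Wd.IsGloballyMinimal],
      (∃ C : WeierstrassCurve.VariableChange ℚ, C • W.quadraticTwist (NumberField.discr K : ℚ) = Wd) →
      Wd.analyticRank = 1 → Nat.card (Wd.selmerGroup 2) = 2 → padicValNat 2 Wd.tamagawaProduct = 0 →
      False := by
  intro W _ _ _ hcm hr0 hρ hT hpos h1 K _ _ hIQ hodd h3 hHe hsq1 hsq2 Dt hoptDt hc β ι d₁ hy Wd _ _ hWd hrd hSel hDEF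
  obtain ⟨ℓ, hℓF, hℓd, hΔ, P₀, hP₀, hbit⟩ :=
    hR W hcm hr0 hρ hT hpos h1 K hIQ hodd h3 hHe hsq1 hsq2 Dt hoptDt hc β ι d₁ hy Wd hWd hrd hSel hDEF
  haveI := hℓF
  have hℓp : ℓ.Prime := hℓF.out
  have hℓ2 : ℓ ≠ 2 := by
    rintro rfl
    obtain ⟨r, hr⟩ := hodd
    omega
  -- the place `v ∋ ℓ`
  obtain ⟨v, hv⟩ : ∃ v : HeightOneSpectrum (𝓞 ℚ), ((primesEquiv v : Nat.Primes) : ℕ) = ℓ :=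
    ⟨primesEquiv.symm ⟨ℓ, hℓp⟩, by rw [Equiv.apply_symm_apply]⟩
  have hvℓ : (ℓ : 𝓞 ℚ) ∈ v.asIdeal := by
    rw [← hv]
    exact Rat.HeightOneSpectrum.natCast_natGenerator_mem v
  obtain ⟨Cd, hCd⟩ := hWd
  have h1v := natCard_twoTorsion_reductionAt_eq_one_of_allSilentTwin W hIQ hodd hHe hT Cd hCd hDEF hℓd hvℓ
  have hρ2 : W.HasSurjectiveModNGaloisRep 2 := by simpa using hρ 1 one_pos
  have h4 : NumberField.discr K ≠ -4 := by
    intro h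
    obtain ⟨r, hr⟩ := hodd
    omega
  have hsq : ¬ IsSquare ((NumberField.discr K : ℚ) * W.Δ) :=
    GenusExact.not_isSquare_discr_mul_Δ_of_satisfiesHeegnerHypothesis W hIQ hHe h4
  obtain ⟨s, hs, hfix, heq⟩ := reductionBit_fails_of_natCard_twoTorsion_reductionAt_eq_one W hIQ hHe hr0 hρ2 hsq hℓ2 hℓd hΔ hvℓ h1v
    Dt β ι d₁ hP₀
  exact hbit s hs hfix heq

end Summit.BirchSwinnertonDyer.BirchSwinnertonDyer.Theorems.GenusSupplyNarrow.DepthZeroSilent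

end
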